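import Summits.Ventures.PercRepro0.PlanarClose
import Summits.Ventures.PercRepro0.TrifCreate
import Summits.Ventures.PercRepro0.Embedding
import Summits.Ventures.PercRepro0.TwoPoint
import Summits.Ventures.PercRepro0.ContAbove
import Summits.Ventures.PercRepro0.TruncDecay

/-!
# Block M closed: the equivalent forms of `T d` with no hypothesis (seat p3)

With P3 · UNIQUE kernel-checked in every dimension (`TrifCreate.P3_Unique_all`, p6) and `p_c(2) = ½`
kernel-checked (`PlanarClose.pc_two_eq_half`, p1 / p2 / p4 / p6), the block-M reductions of
`TwoPoint.lean`, `ContAbove.lean` and `TruncDecay.lean` lose their hypotheses: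

* `L4_Nontrivial_holds (hd : 2 ≤ d) : L4_Nontrivial d` — `1/(2d−1) ≤ p_c(d) < 1` and `p_c(d+1) ≤ p_c(d)`
  (p2's `L2.L4_Nontrivial_of'` fed with `p_c(2) = ½`); in particular `pc_lt_one : p_c(d) < 1` for `d ≥ 2`;
* R_MID-2 · TWO-POINT, unconditional (`d ≥ 1`): `T d ↔ τ_{p_c}(0,x) → 0 ↔ inf_x τ_{p_c}(0,x) = 0`;
* R_MID-3 · TRIANGLE-ANY-d, unconditional (`d ≥ 1`): triangle or bubble condition at `p_c(d)` ⇒ `T d`;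
* PM-A · CONTINUITY-ABOVE, unconditional (`d ≥ 1`): `θ_d` left-continuous on `(p_c, 1]`, and
  `T d ↔ θ_d ∈ C([0,1])`;
* PM-B · UNIFORM-TRUNCATED, unconditional (`d ≥ 2`): `T d ↔` uniform decay of `τ^f_p(0,x)`.

Every statement is an EQUIVALENT FORM or a SUFFICIENT CONDITION for the residual `T d`, `3 ≤ d ≤ 10`;
none of them is asserted or refuted here, and nothing here decides `T d` for any such `d`.
-/

namespace Summit.Ventures.PercRepro0.MidClose

open Filter Topology Set Defs

variable {d : ℕ}

/-- L4 · NONTRIVIAL holds for every `d ≥ 2` (p2's twin, with `p_c(2) = ½` now kernel-checked). -/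
theorem L4_Nontrivial_holds (hd : 2 ≤ d) : L4_Nontrivial d :=
  L2.L4_Nontrivial_of' hd (by rw [PlanarClose.pc_two_eq_half]; norm_num)

/-- `p_c(d) < 1` for every `d ≥ 2`. -/
theorem pc_lt_one (hd : 2 ≤ d) : pc d < 1 := (L4_Nontrivial_holds hd).1.2

/-- `p_c(d) ≤ ½` for every `d ≥ 2`. -/
theorem pc_le_half (hd : 2 ≤ d) : pc d ≤ 1 / 2 := by
  rw [← PlanarClose.pc_two_eq_half]
  exact L2.pc_le_pc_two (fun _ hd' => L2.pcSet_nonempty hd') hd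

/-! ### R_MID-2 / R_MID-3, unconditional -/

/-- R_MID-2 (a) ⟺ (b), no hypothesis (`d ≥ 1`). -/
theorem T_iff_tendsto_tau (hd : 1 ≤ d) :
    T d ↔ Tendsto (fun x : Vertex d => tau d (clamp (pc d)) 0 x) cofinite (𝓝 0) :=
  TwoPoint.T_iff_tendsto_tau hd (TrifCreate.P3_Unique_all d)

/-- R_MID-2 (a) ⟺ (c), no hypothesis (`d ≥ 1`). -/
theorem T_iff_iInf_tau_eq_zero (hd : 1 ≤ d) :
    T d ↔ (⨅ x : Vertex d, tau d (clamp (pc d)) 0 x) = 0 :=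
  TwoPoint.T_iff_iInf_tau_eq_zero hd (TrifCreate.P3_Unique_all d)

/-- R_MID-3, bubble form, no hypothesis (`d ≥ 1`). -/
theorem T_of_bubble (hd : 1 ≤ d) (hB : BubbleCondition d (clamp (pc d))) : T d :=
  TwoPoint.T_of_bubble hd (TrifCreate.P3_Unique_all d) hB

/-- R_MID-3, triangle form, no hypothesis (`d ≥ 1`). -/
theorem T_of_triangle (hd : 1 ≤ d) (hTri : TriangleCondition d (clamp (pc d))) : T d :=
  HighD.T_of_triangle_of_P3 d hd hTri (TrifCreate.P3_Unique_all d)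

/-! ### PM-A / PM-B, unconditional -/

/-- PM-A: `θ_d` is left-continuous at every `p ∈ (p_c(d), 1]`, no hypothesis (`d ≥ 1`). -/
theorem continuousWithinAt_theta_Iio (hd : 1 ≤ d) {p : ℝ} (hp : pc d < p) (hp1 : p ≤ 1) :
    ContinuousWithinAt (theta d) (Iio p) p :=
  ContAbove.continuousWithinAt_theta_Iio hd (TrifCreate.P3_Unique_all d) hp hp1

/-- PM-A consequence: `T d ↔ θ_d` is continuous on `[0,1]`, no hypothesis (`d ≥ 1`). -/
theorem T_iff_continuousOn_theta (hd : 1 ≤ d) : T d ↔ ContinuousOn (theta d) (Icc 0 1) :=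
  ContAbove.T_iff_continuousOn_theta hd (TrifCreate.P3_Unique_all d)

/-- PM-B: `T d ↔` uniform decay of the truncated two-point function, no hypothesis (`d ≥ 2`). -/
theorem T_iff_uniformTruncatedDecay (hd : 2 ≤ d) : T d ↔ TruncDecay.UniformTruncatedDecay d :=
  TruncDecay.T_iff_uniformTruncatedDecay (by omega) (pc_lt_one hd) (TrifCreate.P3_Unique_all d)

/-- The residual in its equivalent forms (`3 ≤ d ≤ 10`): `T d` ⟺ two-point decay ⟺ continuity of
`θ_d` ⟺ uniform truncated decay — each a restatement, none decided here. -/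
theorem TMID_iff_forms :
    TMID ↔ ∀ d : ℕ, 3 ≤ d → d ≤ 10 →
      Tendsto (fun x : Vertex d => tau d (clamp (pc d)) 0 x) cofinite (𝓝 0) :=
  forall_congr' fun d => forall_congr' fun h3 => forall_congr' fun _ =>
    T_iff_tendsto_tau (by omega)

end Summit.Ventures.PercRepro0.MidClose
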